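import Summits.BirchSwinnertonDyer.Rank1Residual.GaloisImage.KatoExpStarFiniteLevel
import Summits.BirchSwinnertonDyer.Rank1Residual.GaloisImage.KolyvaginDerivativeCoefficientChange
import Summits.BirchSwinnertonDyer.Rank1Residual.GaloisImage.TorsionPadicIntCoefficientsLocal
import Summits.BirchSwinnertonDyer.Rank1Residual.GaloisImage.KatoZetaValueConjugation
import Literature.NumberTheory.GaloisRepresentations.ConjugationDescent
import Literature.NumberTheory.GaloisRepresentations.ImaginaryQuadraticCyclotomicProofs
import Literature.NumberTheory.GaloisCohomology.KolyvaginSystems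
import HarnessLib

/-!
# Kolyvagin's parity projection on the Galois side: `res (κ₀ + κ₀) = Ψ (y + g·y)` under PK-5's
# cocycle pin, and the PLUS-SYMMETRISED scalar compatibility of the (P-EXP) rider
# (sub-target T-PK-PAR (T⁺1) of r1 R1-72 (B); cell `b2b-bsdres`, team n1011, ROUTE-1 PORT (P-KIM);
# seat p13 GEN 14 — PK-6 lineage; (T⁺2)'s VALUE side is n1011-p02's `KatoZetaValueConjugation`)

HONEST FRAMING (cell `b2b-bsdres`, run/shared/lean/b2b/bsd-rank1-residual/, verbatim in every
file): the goal of the cell is to DELETE the COMBINATION-SHAPED residual classes of the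
Birch–Swinnerton-Dyer formula for ALL analytic-rank `≤ 1` elliptic curves over `ℚ` — "full BSD
formula for every rank `≤ 1` curve in class `C`" assembled STRICTLY from published theorems — so
that the rank-`≤ 1` remainder becomes exactly the CONSTRUCTION-SHAPED classes, which are TYPED
(missing-input `Prop`s), NOT attempted. This is not "finishing BSD". Team n1011 (N10/N11; ROUTE 1,
the PORT anatomy (P-KIM) of class X4 ∧ `p = 3`): research route on CONSTRUCTION-SHAPED classes;
prove what is provable now; no claim beyond stated classes; census output = EVIDENCE, never a
Literature fact; RESIDUAL-MAP marks UNCHANGED; nothing is booked by this file.  TOOL THEOREMS ONLY: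
no definition, no named fact, no instance, no `sorry`; the (P-EXP) rider `KatoExpStarFiniteLevelAt`
(PK-5, CONSTRUCTION-SHAPED, never `_holds`) and Kato's `ZetaBody` enter as DISPLAYED HYPOTHESES
`hfin` / `hbody`, never asserted; closes nothing on N11.

## What (r1 ROUTE-1 §56.3 (B) "PARITY — the odd part dies WITHOUT integrality", R1-72)

The general-level PORT assembly PK-6 feeds the (P-EXP) rider PK-5 (ii)
(`KatoExpStarFiniteLevelAt.apply_localization_eq_toZModPow`: `res κ₀ = Ψ y`, `loc_v κ₀ ∈ 𝓕_can(v)`,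
`p^t·Λ_{0,r}(y) ≡ s ⊗ 1 (mod p^{k+1}·L_int)` ⟹ `Λfin(loc_v κ₀) = s mod p^{k+1}`) NOT with THEOREM A3's
derivative datum `(y, κ₀) = (D_r z_{0,r}, κ_r)` but with its PLUS-SYMMETRISATION
`(y⁺, κ₀⁺) := (y + g₋·y, κ₀ + κ₀)`, `g₋` any element of the absolute Galois group acting on `ℚ(ζ_n)`,
`n = m(0, r)`, as complex conjugation (`χ_n(g₋) = −1`): the value `Λ_{0,r}(y⁺)` is then the EVEN
element `(1 + 1 ⊗ σ₋₁)(Λ_{0,r} y)` ((T⁺2) = `ZetaBody` (C3a), n1011-p02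
`ZetaValue.zetaBody_apply_add_conjMap_of_eq_neg_one`), whose modular-symbol coefficients are PLUS
symbols, `p`-integral under `Irr(ρ̄)` by a tree theorem — so no minus-side integrality, no depth, no
Manin–Drinfeld binder enters the PORT road.  This file is the GALOIS side plus the assembled socket:

* §1 **(P1)** `apply_conjMap_eq_conjMap_apply_of_pin`: an additive `Ψ : H¹(U, T_pE) → H¹(U, E[p^k·p])`
  computed on cocycles by `a ↦ a_{k+1}` (PK-5 (ii)'s binder `hΨ` VERBATIM) commutes with `conjMap g`
  for every `g` (`U` normal; the coefficient map is equivariant); **(T⁺1)**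
  `resSubgroup_add_self_eq_apply_add_conjMap`: `res_U κ₀ = Ψ y ⟹ res_U (κ₀ + κ₀) = Ψ (y + g·y)` for
  EVERY `g` (restricted classes are conjugation-fixed, `conjMap_resSubgroup_one`) — NO hypothesis
  beyond PK-5's own binders (r1 P56-b).
* §2 `exists_modNCyclotomicCharacter_eq_neg_one`: for every `n ≥ 1` some `g` has `χ_n(g) = −1`
  (`χ_n : Γ_ℚ → (ℤ/n)ˣ` is onto — Washington Thm. 2.5, tree `Rat.modNCyclotomicCharacter_surjective`):
  the displayed `hg` of the (T⁺2) lemmas is dischargeable at every level with NO datum and NO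
  hypothesis (THEOREM A3's own `∏_ℓ σ̃_ℓ^{(ℓ−1)/2}` is one such `g`; it is not needed).
* §3 `p` odd ⟹ `2` is harmless: `isUnit_two_zmod_pow`; `eq_zero_of_add_self_eq_zero` /
  `add_self_eq_zero_iff` (`H¹(ℚ, E[p^k·p])` has no `2`-torsion — `2` acts invertibly on the
  coefficients, `eq_zero_of_smul_eq_zero_one`); `isKolyvaginSystem_add_self` (`κ + κ ∈ KS₁`) — so
  KS-1/KS-3/EXOTIC consume `2κ` exactly as they consume `κ` (`(2κ)_∅ ≠ 0 ⟺ κ_∅ ≠ 0`).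
* §4 ★ `apply_localization_add_self_eq_toZModPow`: PK-5 (ii) APPLIED TO `(y⁺, κ₀ + κ₀)` — under
  `hfin`, from `res κ₀ = Ψ y`, `loc_v κ₀ ∈ 𝓕_can(v)` and `p^t·Λ_{0,r}(y + g·y) ≡ s ⊗ 1
  (mod p^{k+1}·L_int)`: `Λfin(loc_v (κ₀ + κ₀)) = s mod p^{k+1}` (`= 2·Λfin(loc_v κ₀)` by
  additivity); PK-5 binds `y, κ₀, s` freely, so NO variant of the rider is needed.
* §5 ★ `…_of_zetaBody`: the same with the premise in VALUE form through (T⁺2) BY NAME,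
  `p^t·(Λ_{0,r} y + (1 ⊗ σ₋₁)(Λ_{0,r} y)) ≡ s ⊗ 1`, `hg : χ_n(g) = −1` displayed (dischargeable by §2);
  ★ `…_of_zetaBody_deriv` for `y = D·z_{0,r}` (THEOREM A3's operator), premise on the pure tensor
  `1 ⊗ D^{field}(x_{0,r} + σ₋₁ x_{0,r})` (n1011-p02 ★ `zetaBody_apply_deriv_zeta_add_conjMap_eq_tmul_deriv`)
  — the socket PK-4b-C / T-PKEV (E5) fill at the general level.

HONEST LIMITS: nothing here constructs `Λfin`, proves the rider, or supplies the congruence premise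
(PK-4b); nothing about Kolyvagin primes or the END; the `2` is carried, never cancelled inside `H¹`
(only in `ℤ/p^{k+1}`, §3); closes nothing; books nothing; 0 defs / 0 facts.

References: K. Rubin, *Euler Systems* (2000), Def. 4.4.1, Lemma 4.4.2, Def. 4.4.4 [Rubin2000];
J.-P. Serre, *Local Fields* (1979), VII §5 [SerreLocalFields1979]; K. Kato, Astérisque 295 (2004),
§9.4 p. 188, Thm. 9.7 p. 189 [Kato2004Asterisque]; C.-H. Kim, AJM 148 = arXiv:2203.12159, §3.4.1
and the proof of Thm. 3.13 [Kim2022StructureSelmer]; L. Washington, *Cyclotomic Fields*, Thm. 2.5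
[Washington1997]; design `cells/n1011/ROUTE-1.md` §56.3 (B) R1-72 (r1 GEN 44), lead R5-106 (d),
`cells/n1011/skel/T-PORT-1-PKIM.md` v0.5 (11).
-/

noncomputable section

open scoped NumberField TensorProduct
open CategoryTheory Field IsDedekindDomain NumberField WeierstrassCurve
open Literature.NumberTheory.GaloisRepresentations
open Literature.NumberTheory.EllipticCurves Literature.NumberTheory.EllipticCurves.Kato2004
open Literature.NumberTheory.EllipticCurves.Kato2004.EulerSystemValues
open Literature.NumberTheory.GaloisCohomology
open Literature.NumberTheory.GaloisRepresentations.DiscreteGaloisModule (SelmerStructure)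

namespace Summit.BirchSwinnertonDyer.Rank1Residual.GaloisImage.KatoParity

/-! ### §1 The Galois side: PK-5's pinned `Ψ` commutes with `conjMap`; (T⁺1) -/

section Galois

variable {W : WeierstrassCurve ℚ} [W.IsElliptic] {p : ℕ} [Fact p.Prime]
  [ContinuousSMul ℤ_[p] (W.tateModule p)] {k : ℕ}

/-- **(P1) A `Ψ : H¹(U, T_pE) → H¹(U, E[p^k·p])` computed on cocycles by `a ↦ a_{k+1}` (PK-5 (ii)'s
binder `hΨ` verbatim) commutes with the action of every `g` of the absolute Galois group** (`U`
normal): `Ψ (g·y) = g·(Ψ y)` — on cocycles both sides are `x ↦ g • φ(g⁻¹ x g)_{k+1}` (the coefficient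
map is equivariant).  Serre, *Local Fields*, VII §5. [cite: SerreLocalFields1979, VII §5] -/
theorem apply_conjMap_eq_conjMap_apply_of_pin (U : Subgroup (absoluteGaloisGroup ℚ)) [U.Normal]
    (Ψ : H1 (tateRep W p) U →+
      continuousCohomology 1
        (subgroupRep (W.torsionGaloisModule ((p : ℤ) ^ k * (p : ℤ))).toTopRep U))
    (hΨ : ∀ (φ : contOneCocycles (subgroupRep (tateRep W p).toTopRep U))
        (ψ : contOneCocycles
          (subgroupRep (W.torsionGaloisModule ((p : ℤ) ^ k * (p : ℤ))).toTopRep U)),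
        (∀ g, ((ψ.1 g : geomTorsion W ((p : ℤ) ^ k * (p : ℤ))) : geomPoints W) =
          TateModule.proj p (k + 1) (φ.1 g)) →
        Ψ (oneCocycleClass _ φ) = oneCocycleClass _ ψ)
    (g : absoluteGaloisGroup ℚ) (y : H1 (tateRep W p) U) :
    Ψ (conjMap (tateRep W p).toTopRep U g 1 y) =
      conjMap (W.torsionGaloisModule ((p : ℤ) ^ k * (p : ℤ))).toTopRep U g 1 (Ψ y) := by
  obtain ⟨φ, rfl⟩ := oneCocycleClass_surjective _ y
  obtain ⟨ψ, hψ⟩ := Derivative.CoeffChange.EC.comp_proj_mem_contOneCocycles W p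
    (W.continuous_galoisRepTate_holds p) (k + 1) (TorsionCoeff.geomTorsion_pow_succ_eq W p k) U φ
  rw [hΨ φ ψ hψ, conjMap_oneCocycleClass, conjMap_oneCocycleClass]
  refine hΨ _ _ fun x => ?_
  rw [conj_pullback_apply, conj_pullback_apply]
  change ((g • ψ.1 (subgroupConj U g x) : geomTorsion W ((p : ℤ) ^ k * (p : ℤ))) : geomPoints W) =
    TateModule.proj p (k + 1) (g • φ.1 (subgroupConj U g x))
  rw [TateModule.proj_smul_of_distribMulAction, ← hψ]
  rfl

/-- **(T⁺1) Kolyvagin's parity projection on the Galois side.**  If `res_U κ₀ = Ψ y` (the SHAPE of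
THEOREM A3's derivative class — PK-5 (ii)'s binder `hres`), then for EVERY `g` of the absolute
Galois group `res_U (κ₀ + κ₀) = Ψ (y + g·y)`: restricted classes are fixed by the `G/U`-action
(`conjMap_resSubgroup_one`) and `Ψ` commutes with it (P1); no hypothesis beyond PK-5's binders
(r1 P56-b).  Serre, *Local Fields*, VII §5. [cite: Rubin2000, Def. 4.4.4 and Lemma 4.4.2] -/
theorem resSubgroup_add_self_eq_apply_add_conjMap (U : Subgroup (absoluteGaloisGroup ℚ)) [U.Normal]
    (Ψ : H1 (tateRep W p) U →+
      continuousCohomology 1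
        (subgroupRep (W.torsionGaloisModule ((p : ℤ) ^ k * (p : ℤ))).toTopRep U))
    (hΨ : ∀ (φ : contOneCocycles (subgroupRep (tateRep W p).toTopRep U))
        (ψ : contOneCocycles
          (subgroupRep (W.torsionGaloisModule ((p : ℤ) ^ k * (p : ℤ))).toTopRep U)),
        (∀ g, ((ψ.1 g : geomTorsion W ((p : ℤ) ^ k * (p : ℤ))) : geomPoints W) =
          TateModule.proj p (k + 1) (φ.1 g)) →
        Ψ (oneCocycleClass _ φ) = oneCocycleClass _ ψ)
    (g : absoluteGaloisGroup ℚ) (y : H1 (tateRep W p) U)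
    (κ₀ : galoisCohomology (W.torsionGaloisModule ((p : ℤ) ^ k * (p : ℤ))) 1)
    (hres : resSubgroup (W.torsionGaloisModule ((p : ℤ) ^ k * (p : ℤ))).toTopRep U 1 κ₀ = Ψ y) :
    resSubgroup (W.torsionGaloisModule ((p : ℤ) ^ k * (p : ℤ))).toTopRep U 1 (κ₀ + κ₀) =
      Ψ (y + conjMap (tateRep W p).toTopRep U g 1 y) := by
  have hadd : resSubgroup (W.torsionGaloisModule ((p : ℤ) ^ k * (p : ℤ))).toTopRep U 1 (κ₀ + κ₀) =
      resSubgroup (W.torsionGaloisModule ((p : ℤ) ^ k * (p : ℤ))).toTopRep U 1 κ₀ +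
        resSubgroup (W.torsionGaloisModule ((p : ℤ) ^ k * (p : ℤ))).toTopRep U 1 κ₀ :=
    map_add _ _ _
  rw [hadd, map_add, apply_conjMap_eq_conjMap_apply_of_pin U Ψ hΨ g y, ← hres,
    conjMap_resSubgroup_one]

omit [ContinuousSMul ℤ_[p] (W.tateModule p)] in
/-- PK-5 (ii)'s binder `hloc` for the symmetrised class `κ₀ + κ₀` (`𝓕_can(v)` is a subgroup). [folklore] -/
theorem localization_add_self_mem {v : HeightOneSpectrum (𝓞 ℚ)}
    {κ₀ : galoisCohomology (W.torsionGaloisModule ((p : ℤ) ^ k * (p : ℤ))) 1}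
    (hloc : galoisCohomology.localization (W.torsionGaloisModule ((p : ℤ) ^ k * (p : ℤ)))
      (Sum.inr v) 1 κ₀ ∈ propagatedSelmerStructure W p k (Sum.inr v)) :
    galoisCohomology.localization (W.torsionGaloisModule ((p : ℤ) ^ k * (p : ℤ))) (Sum.inr v) 1
        (κ₀ + κ₀) ∈ propagatedSelmerStructure W p k (Sum.inr v) := by
  rw [map_add]
  exact add_mem hloc hloc

end Galois

/-! ### §2 An element acting on `ℚ(ζ_n)` as complex conjugation exists (no datum, no hypothesis) -/

/-- **For every `n ≥ 1` there is `g` in the absolute Galois group of `ℚ` with `χ_n(g) = −1`**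
(`χ_n : Γ_ℚ → (ℤ/n)ˣ` is onto: `Gal(ℚ(ζ_n)/ℚ) ≃ (ℤ/n)ˣ`, Washington Thm. 2.5 — tree
`Rat.modNCyclotomicCharacter_surjective`); discharges the displayed `hg` of the (T⁺2) lemmas at every
level `n = m(k, r)` (THEOREM A3's `∏_ℓ σ̃_ℓ^{(ℓ−1)/2}` is one such `g`, not needed).
[cite: Washington1997, Thm. 2.5] -/
theorem exists_modNCyclotomicCharacter_eq_neg_one (n : ℕ) [NeZero n] :
    ∃ g : absoluteGaloisGroup ℚ, modNCyclotomicCharacter ℚ n g = -1 :=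
  Rat.modNCyclotomicCharacter_surjective n (-1)

/-! ### §3 `p` odd: the factor `2` is harmless -/

section Two

variable {p : ℕ} [Fact p.Prime]

/-- `2` is a unit of `ℤ/p^{k+1}` for `p` odd. [folklore] -/
theorem isUnit_two_zmod_pow (hp2 : p ≠ 2) (k : ℕ) : IsUnit (2 : ZMod (p ^ (k + 1))) := by
  have hcop : Nat.Coprime 2 (p ^ (k + 1)) :=
    ((Nat.coprime_primes Nat.prime_two (Fact.out : p.Prime)).mpr (Ne.symm hp2)).pow_right _
  have h := (ZMod.unitOfCoprime 2 hcop).isUnit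
  rwa [ZMod.coe_unitOfCoprime, Nat.cast_ofNat] at h

variable {W : WeierstrassCurve ℚ} {k : ℕ}

omit [Fact p.Prime] in
/-- `p^{k+1}` kills `E[p^k·p]`. [folklore] -/
theorem pow_succ_nsmul_geomTorsion_eq_zero (P : geomTorsion W ((p : ℤ) ^ k * (p : ℤ))) :
    p ^ (k + 1) • P = 0 := by
  apply Subtype.ext
  rw [AddSubgroupClass.coe_nsmul, ZeroMemClass.coe_zero, ← natCast_zsmul, Nat.cast_pow, pow_succ]
  exact mem_torsionBy_iff.mp P.2

/-- **`H¹(ℚ, E[p^k·p])` has no `2`-torsion for `p` odd**: `x + x = 0 ⟹ x = 0` (`2` acts invertibly on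
the coefficients — `(p^{k+1}+1)/2` is an equivariant inverse — hence on `H¹`,
`eq_zero_of_smul_eq_zero_one`); so `(2κ)_∅ ≠ 0 ⟺ κ_∅ ≠ 0` for R1-72 (B)'s `2κ`. [folklore] -/
theorem eq_zero_of_add_self_eq_zero (hp2 : p ≠ 2)
    (x : galoisCohomology (W.torsionGaloisModule ((p : ℤ) ^ k * (p : ℤ))) 1) (hx : x + x = 0) :
    x = 0 := by
  -- the integer `u = (p^{k+1}+1)/2` with `u * 2 = p^{k+1} + 1`
  have hodd : Odd (p ^ (k + 1)) := ((Fact.out : p.Prime).odd_of_ne_two hp2).pow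
  obtain ⟨u, hu⟩ := hodd.add_one
  let Z := (W.torsionGaloisModule ((p : ℤ) ^ k * (p : ℤ))).toTopRep
  have hcomm : ∀ σ : absoluteGaloisGroup ℚ,
      ((u : ℤ) • ContinuousLinearMap.id ℤ Z).comp (Z.ρ σ) =
        (Z.ρ σ).comp ((u : ℤ) • ContinuousLinearMap.id ℤ Z) := fun σ =>
    ContinuousLinearMap.ext fun v => by
      change (u : ℤ) • Z.ρ σ v = Z.ρ σ ((u : ℤ) • v)
      rw [map_zsmul]
  let e : Z ⟶ Z := TopRep.ofHom ⟨(u : ℤ) • ContinuousLinearMap.id ℤ Z, hcomm⟩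
  have he : ∀ v : Z, e.hom ((2 : ℤ) • v) = v := by
    intro v
    change (u : ℤ) • ((2 : ℤ) • (v : geomTorsion W ((p : ℤ) ^ k * (p : ℤ)))) = v
    rw [← mul_smul, show (u : ℤ) * 2 = ((p ^ (k + 1) + 1 : ℕ) : ℤ) by rw [hu]; push_cast; ring,
      natCast_zsmul, add_smul, one_smul, pow_succ_nsmul_geomTorsion_eq_zero, zero_add]
  refine eq_zero_of_smul_eq_zero_one Z (2 : ℤ) e he x ?_
  rw [two_smul]
  exact hx

/-- `x + x = 0 ↔ x = 0` in `H¹(ℚ, E[p^k·p])`, `p` odd. [folklore] -/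
theorem add_self_eq_zero_iff (hp2 : p ≠ 2)
    (x : galoisCohomology (W.torsionGaloisModule ((p : ℤ) ^ k * (p : ℤ))) 1) :
    x + x = 0 ↔ x = 0 :=
  ⟨eq_zero_of_add_self_eq_zero hp2 x, fun h => by rw [h, add_zero]⟩

/-- **`κ + κ` is again a Kolyvagin system** (for any datum and Selmer structure: `KS₁` is a group,
`KolyvaginDatum.kolyvaginSystems`). [cite: Sakamoto2024, Def. 4.1 (p. 926)] -/
theorem isKolyvaginSystem_add_self {n : ℤ} {D : KolyvaginDatum (W.torsionGaloisModule n)}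
    {𝓕 : SelmerStructure (W.torsionGaloisModule n)}
    {κ : Finset (HeightOneSpectrum (𝓞 ℚ)) → galoisCohomology (W.torsionGaloisModule n) 1}
    (hκ : D.IsKolyvaginSystem 𝓕 κ) : D.IsKolyvaginSystem 𝓕 (κ + κ) :=
  (D.kolyvaginSystems 𝓕).add_mem hκ hκ

/-- The bottom class of `κ + κ` vanishes iff that of `κ` does (`p` odd). [folklore] -/
theorem add_self_apply_eq_zero_iff (hp2 : p ≠ 2)
    (κ : Finset (HeightOneSpectrum (𝓞 ℚ)) →
      galoisCohomology (W.torsionGaloisModule ((p : ℤ) ^ k * (p : ℤ))) 1)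
    (r : Finset (HeightOneSpectrum (𝓞 ℚ))) : (κ + κ) r = 0 ↔ κ r = 0 := by
  rw [Pi.add_apply, add_self_eq_zero_iff hp2]

end Two

/-! ### §4 PK-5 (ii) applied to the symmetrised pair `(y + g·y, κ₀ + κ₀)` -/

section Rider

variable {W : WeierstrassCurve ℚ} [W.IsElliptic] {p : ℕ} [Fact p.Prime]
  [ContinuousSMul ℤ_[p] (W.tateModule p)] {k t : ℕ} {v : HeightOneSpectrum (𝓞 ℚ)}
  {Λ : ∀ (k' : ℕ) (r : Finset (HeightOneSpectrum (𝓞 ℚ))),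
    H1 (tateRep W p) (cycSubgroup p k' r) →ₗ[ℤ_[p]] ℚ_[p] ⊗[ℚ] CyclotomicField (cycLevel p k' r) ℚ}
  {Λfin : galoisCohomology ((W.torsionGaloisModule ((p : ℤ) ^ k * (p : ℤ))).toLocal
    (Sum.inr v)) 1 →+ ZMod (p ^ (k + 1))}

/-- **★ The PLUS-SYMMETRISED scalar compatibility** (PK-5 (ii) for `(y⁺, κ₀⁺) = (y + g·y, κ₀ + κ₀)`,
r1 R1-72 (B)): under the rider, if `res κ₀ = Ψ y`, `loc_v κ₀ ∈ 𝓕_can(v)` and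
`p^t · Λ_{0,r}(y + g·y) ≡ s ⊗ 1 (mod p^{k+1} · L_int)`, then `Λfin(loc_v (κ₀ + κ₀)) = s mod p^{k+1}`
— for EVERY `g` (the intended one has `χ_n(g) = −1`, §2/§5).  The rider binds `y, κ₀, s` freely, so
this is `apply_localization_eq_toZModPow` at `(y⁺, κ₀⁺)` with `hres` from (T⁺1) and `hloc` from
`add_mem`. [cite: Kim2022StructureSelmer, §3.4.1 and the proof of Thm. 3.13 (arXiv v3 pp. 26–27; = Thm. 3.11 of AJM 148)] -/
theorem apply_localization_add_self_eq_toZModPow (h : KatoExpStarFiniteLevelAt W p k t v Λ Λfin)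
    (r : Finset (HeightOneSpectrum (𝓞 ℚ)))
    (Ψ : H1 (tateRep W p) (cycSubgroup p 0 r) →+
      continuousCohomology 1
        (subgroupRep (W.torsionGaloisModule ((p : ℤ) ^ k * (p : ℤ))).toTopRep (cycSubgroup p 0 r)))
    (hΨ : ∀ (φ : contOneCocycles (subgroupRep (tateRep W p).toTopRep (cycSubgroup p 0 r)))
        (ψ : contOneCocycles
          (subgroupRep (W.torsionGaloisModule ((p : ℤ) ^ k * (p : ℤ))).toTopRep (cycSubgroup p 0 r))),
        (∀ g, ((ψ.1 g : geomTorsion W ((p : ℤ) ^ k * (p : ℤ))) : geomPoints W) =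
          TateModule.proj p (k + 1) (φ.1 g)) →
        Ψ (oneCocycleClass _ φ) = oneCocycleClass _ ψ)
    (g : absoluteGaloisGroup ℚ) (y : H1 (tateRep W p) (cycSubgroup p 0 r))
    (κ₀ : galoisCohomology (W.torsionGaloisModule ((p : ℤ) ^ k * (p : ℤ))) 1) (s : ℤ_[p])
    (hres : resSubgroup (W.torsionGaloisModule ((p : ℤ) ^ k * (p : ℤ))).toTopRep (cycSubgroup p 0 r)
      1 κ₀ = Ψ y)
    (hloc : galoisCohomology.localization (W.torsionGaloisModule ((p : ℤ) ^ k * (p : ℤ))) (Sum.inr v)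
      1 κ₀ ∈ propagatedSelmerStructure W p k (Sum.inr v))
    (hval : ∃ l ∈ cycIntLattice p (cycLevel p 0 r),
      ((p : ℤ_[p]) ^ t) • Λ 0 r (y + conjMap (tateRep W p).toTopRep (cycSubgroup p 0 r) g 1 y) -
          ((s : ℚ_[p]) ⊗ₜ[ℚ] (1 : CyclotomicField (cycLevel p 0 r) ℚ)) =
        ((p : ℤ_[p]) ^ (k + 1)) • (l : ℚ_[p] ⊗[ℚ] CyclotomicField (cycLevel p 0 r) ℚ)) :
    Λfin (galoisCohomology.localization (W.torsionGaloisModule ((p : ℤ) ^ k * (p : ℤ)))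
        (Sum.inr v) 1 (κ₀ + κ₀)) = PadicInt.toZModPow (k + 1) s :=
  h.apply_localization_eq_toZModPow r Ψ hΨ _ (κ₀ + κ₀) s
    (resSubgroup_add_self_eq_apply_add_conjMap _ Ψ hΨ g y κ₀ hres) (localization_add_self_mem hloc)
    hval

end Rider

/-! ### §5 With Kato's `ZetaBody`: the premise in VALUE form through (T⁺2) by name -/

section Zeta

variable {W : WeierstrassCurve ℚ} [W.IsElliptic] {p : ℕ} [Fact p.Prime]
  [ContinuousSMul ℤ_[p] (W.tateModule p)] [Module.Free ℤ_[p] (W.tateModule p)]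
  [Module.Finite ℤ_[p] (W.tateModule p)] {N : ℕ} {f : CuspForm (CongruenceSubgroup.Gamma0 N) 2}
  {ι : (m : ℕ) → (CyclotomicField m ℚ →+* ℂ)} {κ : ℝ}
  {Λ : ∀ (k' : ℕ) (r : Finset (HeightOneSpectrum (𝓞 ℚ))),
    H1 (tateRep W p) (cycSubgroup p k' r) →ₗ[ℤ_[p]] ℚ_[p] ⊗[ℚ] CyclotomicField (cycLevel p k' r) ℚ}
  {c d a : ℤ} {A : ℕ}
  {z : ∀ (k' : ℕ) (r : (cyclotomicLevelsRat p (badPlaces c d A N)).Ideals),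
    H1 (tateRep W p) ((cyclotomicLevelsRat p (badPlaces c d A N)).level k' r.1)}
  {x : ∀ (k' : ℕ) (r : (cyclotomicLevelsRat p (badPlaces c d A N)).Ideals),
    CyclotomicField (cycLevel p k' r.1) ℚ}
  {k t : ℕ} {v : HeightOneSpectrum (𝓞 ℚ)}
  {Λfin : galoisCohomology ((W.torsionGaloisModule ((p : ℤ) ^ k * (p : ℤ))).toLocal
    (Sum.inr v)) 1 →+ ZMod (p ^ (k + 1))}

/-- **★ (T⁺1) ∘ (T⁺2): the symmetrised scalar compatibility, premise in VALUE form.**  Under `hbody`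
and the rider, for `g` with `χ_n(g) = −1` (`n = m(0, r)`; displayed, dischargeable by §2), from
`res κ₀ = Ψ y`, `loc_v κ₀ ∈ 𝓕_can(v)` and `p^t·(Λ_{0,r} y + (1 ⊗ σ₋₁)(Λ_{0,r} y)) ≡ s ⊗ 1
(mod p^{k+1}·L_int)`: `Λfin(loc_v (κ₀ + κ₀)) = s mod p^{k+1}` (the value of `y + g·y` is n1011-p02's
`ZetaValue.zetaBody_apply_add_conjMap_of_eq_neg_one`). [cite: Kato2004Asterisque, §9.4 (p. 188)]
[cite: Kim2022StructureSelmer, §3.4.1 and the proof of Thm. 3.13 (arXiv v3 pp. 26–27; = Thm. 3.11 of AJM 148)] -/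
theorem apply_localization_add_self_eq_toZModPow_of_zetaBody
    (hbody : ZetaBody W p f ι κ Λ c d a A z x) (hfin : KatoExpStarFiniteLevelAt W p k t v Λ Λfin)
    (r : Finset (HeightOneSpectrum (𝓞 ℚ)))
    (Ψ : H1 (tateRep W p) (cycSubgroup p 0 r) →+
      continuousCohomology 1
        (subgroupRep (W.torsionGaloisModule ((p : ℤ) ^ k * (p : ℤ))).toTopRep (cycSubgroup p 0 r)))
    (hΨ : ∀ (φ : contOneCocycles (subgroupRep (tateRep W p).toTopRep (cycSubgroup p 0 r)))
        (ψ : contOneCocycles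
          (subgroupRep (W.torsionGaloisModule ((p : ℤ) ^ k * (p : ℤ))).toTopRep (cycSubgroup p 0 r))),
        (∀ g, ((ψ.1 g : geomTorsion W ((p : ℤ) ^ k * (p : ℤ))) : geomPoints W) =
          TateModule.proj p (k + 1) (φ.1 g)) →
        Ψ (oneCocycleClass _ φ) = oneCocycleClass _ ψ)
    {g : absoluteGaloisGroup ℚ} (hg : modNCyclotomicCharacter ℚ (cycLevel p 0 r) g = -1)
    (y : H1 (tateRep W p) (cycSubgroup p 0 r))
    (κ₀ : galoisCohomology (W.torsionGaloisModule ((p : ℤ) ^ k * (p : ℤ))) 1) (s : ℤ_[p])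
    (hres : resSubgroup (W.torsionGaloisModule ((p : ℤ) ^ k * (p : ℤ))).toTopRep (cycSubgroup p 0 r)
      1 κ₀ = Ψ y)
    (hloc : galoisCohomology.localization (W.torsionGaloisModule ((p : ℤ) ^ k * (p : ℤ))) (Sum.inr v)
      1 κ₀ ∈ propagatedSelmerStructure W p k (Sum.inr v))
    (hval : ∃ l ∈ cycIntLattice p (cycLevel p 0 r),
      ((p : ℤ_[p]) ^ t) • (Λ 0 r y + Algebra.TensorProduct.map (AlgHom.id ℚ ℚ_[p])
          (sigma (cycLevel p 0 r) (-1) :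
            CyclotomicField (cycLevel p 0 r) ℚ →ₐ[ℚ] CyclotomicField (cycLevel p 0 r) ℚ) (Λ 0 r y)) -
          ((s : ℚ_[p]) ⊗ₜ[ℚ] (1 : CyclotomicField (cycLevel p 0 r) ℚ)) =
        ((p : ℤ_[p]) ^ (k + 1)) • (l : ℚ_[p] ⊗[ℚ] CyclotomicField (cycLevel p 0 r) ℚ)) :
    Λfin (galoisCohomology.localization (W.torsionGaloisModule ((p : ℤ) ^ k * (p : ℤ)))
        (Sum.inr v) 1 (κ₀ + κ₀)) = PadicInt.toZModPow (k + 1) s := by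
  refine apply_localization_add_self_eq_toZModPow hfin r Ψ hΨ g y κ₀ s hres hloc ?_
  rwa [ZetaValue.zetaBody_apply_add_conjMap_of_eq_neg_one W p f ι κ Λ c d a A z x hbody 0 r hg y]

/-- **★ The same for THEOREM A3's derivative `y = D · z_{0,r}`** (`D = ∏_{ℓ∈s} Σ_{j<N_ℓ} j·σ_ℓ^j`):
the premise is on the PURE TENSOR `1 ⊗ D^{field}(x_{0,r} + σ₋₁ x_{0,r})` (n1011-p02 ★
`ZetaValue.zetaBody_apply_deriv_zeta_add_conjMap_eq_tmul_deriv`, PK-1 ★2 + (C3a)) — the socket PK-4b-C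
/ T-PKEV (E5) fill at the general level. [cite: Kato2004Asterisque, Thm. 9.7 (p. 189) and §9.4 (p. 188)]
[cite: Kim2022StructureSelmer, §3.4.1 and the proof of Thm. 3.13 (arXiv v3 pp. 26–27; = Thm. 3.11 of AJM 148)] -/
theorem apply_localization_add_self_eq_toZModPow_of_zetaBody_deriv
    (hbody : ZetaBody W p f ι κ Λ c d a A z x) (hfin : KatoExpStarFiniteLevelAt W p k t v Λ Λfin)
    (r : (cyclotomicLevelsRat p (badPlaces c d A N)).Ideals)
    (Ψ : H1 (tateRep W p) (cycSubgroup p 0 r.1) →+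
      continuousCohomology 1
        (subgroupRep (W.torsionGaloisModule ((p : ℤ) ^ k * (p : ℤ))).toTopRep (cycSubgroup p 0 r.1)))
    (hΨ : ∀ (φ : contOneCocycles (subgroupRep (tateRep W p).toTopRep (cycSubgroup p 0 r.1)))
        (ψ : contOneCocycles
          (subgroupRep (W.torsionGaloisModule ((p : ℤ) ^ k * (p : ℤ))).toTopRep
            (cycSubgroup p 0 r.1))),
        (∀ g, ((ψ.1 g : geomTorsion W ((p : ℤ) ^ k * (p : ℤ))) : geomPoints W) =
          TateModule.proj p (k + 1) (φ.1 g)) →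
        Ψ (oneCocycleClass _ φ) = oneCocycleClass _ ψ)
    {ι' : Type*} (σ : ι' → absoluteGaloisGroup ℚ) (Nℓ : ι' → ℕ) (s' : Finset ι') (comm)
    {g : absoluteGaloisGroup ℚ} (hg : modNCyclotomicCharacter ℚ (cycLevel p 0 r.1) g = -1)
    (κ₀ : galoisCohomology (W.torsionGaloisModule ((p : ℤ) ^ k * (p : ℤ))) 1) (s : ℤ_[p])
    (hres : resSubgroup (W.torsionGaloisModule ((p : ℤ) ^ k * (p : ℤ))).toTopRep (cycSubgroup p 0 r.1)
      1 κ₀ = Ψ (s'.noncommProd (fun ℓ => ∑ j ∈ Finset.range (Nℓ ℓ),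
        (j : Module.End ℤ_[p] (H1 (tateRep W p) (cycSubgroup p 0 r.1))) *
          (conjMap (tateRep W p).toTopRep (cycSubgroup p 0 r.1) (σ ℓ) 1).hom.toLinearMap ^ j) comm
            (z 0 r)))
    (hloc : galoisCohomology.localization (W.torsionGaloisModule ((p : ℤ) ^ k * (p : ℤ))) (Sum.inr v)
      1 κ₀ ∈ propagatedSelmerStructure W p k (Sum.inr v))
    (hval : ∃ l ∈ cycIntLattice p (cycLevel p 0 r.1),
      ((p : ℤ_[p]) ^ t) • ((1 : ℚ_[p]) ⊗ₜ[ℚ]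
        (s'.noncommProd (fun ℓ => ∑ j ∈ Finset.range (Nℓ ℓ),
            (j : Module.End ℚ (CyclotomicField (cycLevel p 0 r.1) ℚ)) *
              (sigma (cycLevel p 0 r.1) (modNCyclotomicCharacter ℚ (cycLevel p 0 r.1) (σ ℓ)) :
                CyclotomicField (cycLevel p 0 r.1) ℚ →ₐ[ℚ]
                  CyclotomicField (cycLevel p 0 r.1) ℚ).toLinearMap ^ j)
            (ZetaValue.pairwise_commute_fieldDeriv (cycLevel p 0 r.1)
              (fun ℓ => modNCyclotomicCharacter ℚ (cycLevel p 0 r.1) (σ ℓ)) Nℓ s')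
          (x 0 r + sigma (cycLevel p 0 r.1) (-1) (x 0 r)))) -
          ((s : ℚ_[p]) ⊗ₜ[ℚ] (1 : CyclotomicField (cycLevel p 0 r.1) ℚ)) =
        ((p : ℤ_[p]) ^ (k + 1)) • (l : ℚ_[p] ⊗[ℚ] CyclotomicField (cycLevel p 0 r.1) ℚ)) :
    Λfin (galoisCohomology.localization (W.torsionGaloisModule ((p : ℤ) ^ k * (p : ℤ)))
        (Sum.inr v) 1 (κ₀ + κ₀)) = PadicInt.toZModPow (k + 1) s := by
  refine apply_localization_add_self_eq_toZModPow hfin r.1 Ψ hΨ g _ κ₀ s hres hloc ?_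
  rwa [ZetaValue.zetaBody_apply_deriv_zeta_add_conjMap_eq_tmul_deriv W p f ι κ Λ c d a A z x hbody 0
    r σ Nℓ s' comm hg]

end Zeta

end Summit.BirchSwinnertonDyer.Rank1Residual.GaloisImage.KatoParity

end
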